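import Summits.NavierStokesRegularity.NavierStokesRegularity.Theorems.ExtremiserTransienceNearExtremalTransienceExtremiserLiouvilleConstantSpeedSlideQuotientBounds
import Summits.NavierStokesRegularity.NavierStokesRegularity.Theorems.ExtremiserTransienceNearExtremalTransienceExtremiserLiouvilleConstantSpeedSlideQuotientL2
import Summits.NavierStokesRegularity.NavierStokesRegularity.Theorems.ExtremiserTransienceNearExtremalTransienceExtremiserLiouvilleConstantSpeedSlideAverage
import HarnessLib

/-!
# Crux `ExtremiserTransience.NearExtremalTransience` (stmt-NavierStokesRegularity-21883), line `extremiser_liouville`,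
# stub K1b — **`h⁻¹Dφ̂_h → Dφ_g` in `L²`**: the discrete slide converges to the slide generator in gradient norm (blueprint L4)

`--supports stmt-NavierStokesRegularity-21883` (helper).  Author: prover seat `ns-el-k1b` (g8).  Record:
`Cruxes/NearExtremalTransience/Lines/extremiser_liouville_k1b_slide.md` §12 (v).

With `Ψ = g(x₂)V`, `G = g′(x₂)V₂`: `φ̂_h = Ψ − Ψ(·−he₂) − (∫_{−h}^{0}G(·+te₂)dt)e₂` and `φ_g = g∂₂V + g′V_h = ∂₂Ψ − Ge₂`, so
```
  h⁻¹Dφ̂_h − Dφ_g = [ h⁻¹(DΨ − DΨ(·−he₂)) − ∂₂DΨ ] − [ h⁻¹∫_{−h}^{0}DG(·+te₂)dt − DG ] ⊗ e₂ ,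
```
a backward difference quotient of `DΨ ∈ C¹` (`∂₂DΨ ∈ L²` as `D²Ψ ∈ L²`, `…SlideQuotientL2`) and a sliding average of
`DG ∈ L²` — both `→ 0` in `L²` by the translation toolkit (`…SlideTranslation`, `…SlideAverage`):
* `fderiv_slideGenerator_eq'` : `Dφ_g = (D²Ψ)e₂ − DG ⊗ e₂` (symmetry of `D²Ψ`);
* `fderiv_slideQuotient_eq` : `Dφ̂_h = DΨ − DΨ(·−he₂) − (∫_{−h}^{0}DG(·+te₂)dt) ⊗ e₂`;
* `tendsto_lintegral_fderiv_slideQuotient_sub` : **`∫‖h⁻¹Dφ̂_h − Dφ_g‖² → 0` as `h → 0⁺`**.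
Since `curl = curlCLM ∘ D`, also `h⁻¹curl φ̂_h → curl φ_g` in `L²`; hence `h⁻¹J₁(φ̂_h) → J₁(φ_g)` and `h⁻¹a₁(φ̂_h) → a₁(φ_g)`
(pairings with fixed `L²`/bounded quantities of `v`), the inputs of the `h → 0⁺` limit of `slideKKT` (next files; the
`c₁`-part uses the discrete product rule instead).

WHAT THIS IS NOT: K1b is NOT proved; nothing here proves NS regularity. [folklore]
-/

noncomputable section

open Set Filter Topology MeasureTheory Metric Function InnerProductSpace
open scoped ENNReal NNReal Topology InnerProductSpace RealInnerProductSpace ContDiff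
open Literature.Analysis.FluidPDE Literature.Analysis

namespace Summit.NavierStokesRegularity.NavierStokesRegularity.Theorems

-- the problem directory repeats the summit name (`NavierStokesRegularity/NavierStokesRegularity`)
set_option linter.dupNamespace false

namespace ExtremiserLiouville

open DepletionLadder.KStar

variable {V : EuclideanSpace ℝ (Fin 3) → EuclideanSpace ℝ (Fin 3)} {g : ℝ → ℝ}

/-! ## 1. The two gradients -/

/-- `φ_g = ∂₂(gV) − (g′V₂)e₂` pointwise. [folklore] -/
theorem slideGenerator_eq_fderiv_sub (hVd : Differentiable ℝ V) (hgd : Differentiable ℝ g) (y : EuclideanSpace ℝ (Fin 3)) :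
    g (y 2) • fderiv ℝ V y (EuclideanSpace.single (2 : Fin 3) (1 : ℝ)) +
        deriv g (y 2) • (V y - (V y 2) • EuclideanSpace.single (2 : Fin 3) (1 : ℝ)) =
      fderiv ℝ (fun z : EuclideanSpace ℝ (Fin 3) => g (z 2) • V z) y (EuclideanSpace.single (2 : Fin 3) (1 : ℝ)) -
        (deriv g (y 2) * V y 2) • EuclideanSpace.single (2 : Fin 3) (1 : ℝ) := by
  rw [(hasFDerivAt_axialWeight_smul hVd hgd y).fderiv]
  simp only [add_apply, smul_apply, ContinuousLinearMap.smulRight_apply]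
  have e2 : (EuclideanSpace.proj (2 : Fin 3) : EuclideanSpace ℝ (Fin 3) →L[ℝ] ℝ) (EuclideanSpace.single (2 : Fin 3) (1 : ℝ)) = 1 := by
    simp
  rw [e2, smul_sub, smul_smul, smul_eq_mul, mul_one]
  abel

/-- **`Dφ_g = (D²Ψ)e₂ − DG ⊗ e₂`** (`Ψ = g(x₂)V`, `G = g′(x₂)V₂`; symmetry of second derivatives). [folklore] -/
theorem fderiv_slideGenerator_eq' (hV : ContDiff ℝ ∞ V) (hg : ContDiff ℝ ∞ g) (x : EuclideanSpace ℝ (Fin 3)) :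
    fderiv ℝ (fun y : EuclideanSpace ℝ (Fin 3) => g (y 2) • fderiv ℝ V y (EuclideanSpace.single (2 : Fin 3) (1 : ℝ)) +
        deriv g (y 2) • (V y - (V y 2) • EuclideanSpace.single (2 : Fin 3) (1 : ℝ))) x =
      fderiv ℝ (fderiv ℝ (fun z : EuclideanSpace ℝ (Fin 3) => g (z 2) • V z)) x (EuclideanSpace.single (2 : Fin 3) (1 : ℝ)) -
        (fderiv ℝ (fun z : EuclideanSpace ℝ (Fin 3) => deriv g (z 2) * V z 2) x).smulRight
          (EuclideanSpace.single (2 : Fin 3) (1 : ℝ)) := by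
  set e₂ : EuclideanSpace ℝ (Fin 3) := EuclideanSpace.single (2 : Fin 3) (1 : ℝ) with he₂
  set Ψ : EuclideanSpace ℝ (Fin 3) → EuclideanSpace ℝ (Fin 3) := fun z => g (z 2) • V z with hΨ
  set G : EuclideanSpace ℝ (Fin 3) → ℝ := fun z => deriv g (z 2) * V z 2 with hG
  have hVd : Differentiable ℝ V := hV.differentiable (by simp)
  have hgd : Differentiable ℝ g := hg.differentiable (by simp)
  have hproj : ContDiff ℝ ∞ fun y : EuclideanSpace ℝ (Fin 3) => y 2 :=
    (EuclideanSpace.proj (2 : Fin 3) : EuclideanSpace ℝ (Fin 3) →L[ℝ] ℝ).contDiff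
  have hΨs : ContDiff ℝ ∞ Ψ := (hg.comp hproj).smul hV
  have hΨ2 : ContDiff ℝ 2 Ψ := hΨs.of_le (WithTop.coe_le_coe.mpr le_top)
  have hγ : ContDiff ℝ ∞ (deriv g) := (contDiff_infty_iff_deriv.mp hg).2
  have hGs : ContDiff ℝ ∞ G := (hγ.comp hproj).mul (hproj.comp hV)
  have hGd : Differentiable ℝ G := hGs.differentiable (by simp)
  have hd : DifferentiableAt ℝ (fderiv ℝ Ψ) x :=
    ((hΨ2.fderiv_right (m := 1) (by norm_num)).differentiable one_ne_zero) x
  have hfun : (fun y : EuclideanSpace ℝ (Fin 3) => g (y 2) • fderiv ℝ V y e₂ + deriv g (y 2) • (V y - (V y 2) • e₂)) =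
      fun y => fderiv ℝ Ψ y e₂ - G y • e₂ := by
    funext y; exact slideGenerator_eq_fderiv_sub hVd hgd y
  have hd1 : DifferentiableAt ℝ (fun y => fderiv ℝ Ψ y e₂) x := hd.clm_apply (differentiableAt_const e₂)
  rw [hfun, fderiv_fun_sub hd1 ((hGd x).smul_const e₂), fderiv_smul_const (hGd x)]
  congr 1
  rw [fderiv_clm_apply hd (differentiableAt_const e₂)]
  simp only [fderiv_fun_const, Pi.zero_apply, ContinuousLinearMap.comp_zero, zero_add]
  refine ContinuousLinearMap.ext fun v => ?_
  rw [ContinuousLinearMap.flip_apply]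
  exact (hΨ2.contDiffAt.isSymmSndFDerivAt (by simp)) v e₂

/-- **`Dφ̂_h = DΨ − DΨ(·−he₂) − (∫_{−h}^{0}DG(·+te₂)dt) ⊗ e₂`**. [folklore] -/
theorem fderiv_slideQuotient_eq (hV : ContDiff ℝ ∞ V) (hg : ContDiff ℝ ∞ g) (h : ℝ) (x : EuclideanSpace ℝ (Fin 3)) :
    fderiv ℝ (fun x : EuclideanSpace ℝ (Fin 3) =>
        g (x 2) • V x - g ((x + (-h) • EuclideanSpace.single (2 : Fin 3) (1 : ℝ)) 2) •
            V (x + (-h) • EuclideanSpace.single (2 : Fin 3) (1 : ℝ)) -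
          (∫ t in (-h)..0, deriv g ((x + t • EuclideanSpace.single (2 : Fin 3) (1 : ℝ)) 2) *
              V (x + t • EuclideanSpace.single (2 : Fin 3) (1 : ℝ)) 2) • EuclideanSpace.single (2 : Fin 3) (1 : ℝ)) x =
      fderiv ℝ (fun z : EuclideanSpace ℝ (Fin 3) => g (z 2) • V z) x -
        fderiv ℝ (fun z : EuclideanSpace ℝ (Fin 3) => g (z 2) • V z) (x + (-h) • EuclideanSpace.single (2 : Fin 3) (1 : ℝ)) -
        (∫ t in (-h)..0, fderiv ℝ (fun z : EuclideanSpace ℝ (Fin 3) => deriv g (z 2) * V z 2)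
          (x + t • EuclideanSpace.single (2 : Fin 3) (1 : ℝ))).smulRight (EuclideanSpace.single (2 : Fin 3) (1 : ℝ)) := by
  set e₂ : EuclideanSpace ℝ (Fin 3) := EuclideanSpace.single (2 : Fin 3) (1 : ℝ) with he₂
  set Ψ : EuclideanSpace ℝ (Fin 3) → EuclideanSpace ℝ (Fin 3) := fun z => g (z 2) • V z with hΨ
  set G : EuclideanSpace ℝ (Fin 3) → ℝ := fun z => deriv g (z 2) * V z 2 with hG
  set F : EuclideanSpace ℝ (Fin 3) → ℝ := fun y => ∫ t in (-h)..0, G (y + t • e₂) with hF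
  have hVd : Differentiable ℝ V := hV.differentiable (by simp)
  have hgd : Differentiable ℝ g := hg.differentiable (by simp)
  have hproj : ContDiff ℝ ∞ fun y : EuclideanSpace ℝ (Fin 3) => y 2 :=
    (EuclideanSpace.proj (2 : Fin 3) : EuclideanSpace ℝ (Fin 3) →L[ℝ] ℝ).contDiff
  have hγ : ContDiff ℝ ∞ (deriv g) := (contDiff_infty_iff_deriv.mp hg).2
  have hGs : ContDiff ℝ ∞ G := (hγ.comp hproj).mul (hproj.comp hV)
  have hG1 : ContDiff ℝ 1 G := hGs.of_le (WithTop.coe_le_coe.mpr le_top)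
  have hΨd : Differentiable ℝ Ψ := fun y => (hasFDerivAt_axialWeight_smul hVd hgd y).differentiableAt
  have hΨad : Differentiable ℝ fun y => Ψ (y + (-h) • e₂) := hΨd.comp (differentiable_id.add_const _)
  have hFd : Differentiable ℝ F := differentiable_verticalIntegral hG1 (-h) 0
  have hFe : Differentiable ℝ fun y => F y • e₂ := hFd.smul_const e₂
  have hfun : (fun y : EuclideanSpace ℝ (Fin 3) => g (y 2) • V y - g ((y + (-h) • e₂) 2) • V (y + (-h) • e₂) -
      (∫ t in (-h)..0, deriv g ((y + t • e₂) 2) * V (y + t • e₂) 2) • e₂) =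
      fun y => Ψ y - Ψ (y + (-h) • e₂) - F y • e₂ := rfl
  have hΨΨad : Differentiable ℝ fun y => Ψ y - Ψ (y + (-h) • e₂) := hΨd.sub hΨad
  rw [hfun, fderiv_fun_sub (hΨΨad x) (hFe x), fderiv_fun_sub (hΨd x) (hΨad x), fderiv_comp_add_right,
    fderiv_smul_const (hFd x)]
  simp only [hF]
  rw [fderiv_verticalIntegral_eq hG1 (-h) 0 x]

/-! ## 2. The limit -/

/-- **`h⁻¹Dφ̂_h → Dφ_g` in `L²(ℝ³)`** as `h → 0⁺`, for the residue object on a square-integrable layer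
(`V, g ∈ C^∞`; `g, g′, g″, g‴` bounded; `g′, g″, g‴ = 0` off `[−T,T]`; `D¹V, D²V ∈ L²`; slab `{|x₂| ≤ T}` square integrable).
[folklore] -/
theorem tendsto_lintegral_fderiv_slideQuotient_sub (hV : ContDiff ℝ ∞ V) (hg : ContDiff ℝ ∞ g) {T K0 K1 K2 K3 : ℝ}
    (hK0 : ∀ s, |g s| ≤ K0) (hK1 : ∀ s, |deriv g s| ≤ K1) (hK2 : ∀ s, |deriv (deriv g) s| ≤ K2)
    (hK3 : ∀ s, |deriv (deriv (deriv g)) s| ≤ K3)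
    (hT1 : ∀ s, T < |s| → deriv g s = 0) (hT2 : ∀ s, T < |s| → deriv (deriv g) s = 0)
    (hT3 : ∀ s, T < |s| → deriv (deriv (deriv g)) s = 0)
    (h1 : ∫⁻ x, ‖iteratedFDeriv ℝ 1 V x‖ₑ ^ 2 < ⊤) (h2 : ∫⁻ x, ‖iteratedFDeriv ℝ 2 V x‖ₑ ^ 2 < ⊤)
    (hslab : Integrable (fun x => {x : EuclideanSpace ℝ (Fin 3) | |x 2| ≤ T}.indicator (fun x => ‖V x‖ ^ 2) x) volume) :
    Tendsto (fun h : ℝ => ∫⁻ x, ‖h⁻¹ • fderiv ℝ (fun x : EuclideanSpace ℝ (Fin 3) =>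
        g (x 2) • V x - g ((x + (-h) • EuclideanSpace.single (2 : Fin 3) (1 : ℝ)) 2) •
            V (x + (-h) • EuclideanSpace.single (2 : Fin 3) (1 : ℝ)) -
          (∫ t in (-h)..0, deriv g ((x + t • EuclideanSpace.single (2 : Fin 3) (1 : ℝ)) 2) *
              V (x + t • EuclideanSpace.single (2 : Fin 3) (1 : ℝ)) 2) • EuclideanSpace.single (2 : Fin 3) (1 : ℝ)) x -
        fderiv ℝ (fun y : EuclideanSpace ℝ (Fin 3) => g (y 2) • fderiv ℝ V y (EuclideanSpace.single (2 : Fin 3) (1 : ℝ)) +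
          deriv g (y 2) • (V y - (V y 2) • EuclideanSpace.single (2 : Fin 3) (1 : ℝ))) x‖ₑ ^ 2)
      (𝓝[>] 0) (𝓝 0) := by
  set e₂ : EuclideanSpace ℝ (Fin 3) := EuclideanSpace.single (2 : Fin 3) (1 : ℝ) with he₂
  set Ψ : EuclideanSpace ℝ (Fin 3) → EuclideanSpace ℝ (Fin 3) := fun z => g (z 2) • V z with hΨ
  set G : EuclideanSpace ℝ (Fin 3) → ℝ := fun z => deriv g (z 2) * V z 2 with hG
  have hproj : ContDiff ℝ ∞ fun y : EuclideanSpace ℝ (Fin 3) => y 2 :=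
    (EuclideanSpace.proj (2 : Fin 3) : EuclideanSpace ℝ (Fin 3) →L[ℝ] ℝ).contDiff
  have hΨs : ContDiff ℝ ∞ Ψ := (hg.comp hproj).smul hV
  have hγ : ContDiff ℝ ∞ (deriv g) := (contDiff_infty_iff_deriv.mp hg).2
  have hGs : ContDiff ℝ ∞ G := (hγ.comp hproj).mul (hproj.comp hV)
  have hDΨs : ContDiff ℝ ∞ (fderiv ℝ Ψ) := hΨs.fderiv_right (m := ∞) (by exact_mod_cast le_rfl)
  have hDΨ1 : ContDiff ℝ 1 (fderiv ℝ Ψ) := hDΨs.of_le (WithTop.coe_le_coe.mpr le_top)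
  have hDGc : Continuous (fderiv ℝ G) := hGs.continuous_fderiv (by simp)
  -- `L²` facts
  obtain ⟨-, hΨ2⟩ := lintegral_iteratedFDeriv_axialWeight_smul_lt_top hV hg hK0 hK1 hK2 hT1 hT2 h1 h2 hslab
  obtain ⟨hG1, -⟩ := lintegral_iteratedFDeriv_axialWeight_mul_coord_lt_top hV hg hK1 hK2 hK3 hT2 hT3 h1 h2 hslab
  have hDa : MemLp (fun x => fderiv ℝ (fderiv ℝ Ψ) x e₂) 2 (volume : Measure (EuclideanSpace ℝ (Fin 3))) := by
    have hc : Continuous fun x => fderiv ℝ (fderiv ℝ Ψ) x e₂ := (hDΨs.continuous_fderiv (by simp)).clm_apply continuous_const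
    refine ⟨hc.aestronglyMeasurable, lintegral_enorm_sq_lt_top_iff_eLpNorm.1 (lt_of_le_of_lt (lintegral_mono fun x => ?_) hΨ2)⟩
    have hle : ‖fderiv ℝ (fderiv ℝ Ψ) x e₂‖ ≤ ‖iteratedFDeriv ℝ 2 Ψ x‖ := by
      rw [← norm_iteratedFDeriv_fderiv, ← norm_iteratedFDeriv_fderiv, norm_iteratedFDeriv_zero]
      calc ‖fderiv ℝ (fderiv ℝ Ψ) x e₂‖ ≤ ‖fderiv ℝ (fderiv ℝ Ψ) x‖ * ‖e₂‖ := ContinuousLinearMap.le_opNorm _ _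
        _ = ‖fderiv ℝ (fderiv ℝ Ψ) x‖ := by rw [he₂, PiLp.norm_single, norm_one, mul_one]
    rw [← ofReal_norm, ← ofReal_norm]
    exact pow_le_pow_left' (ENNReal.ofReal_le_ofReal hle) 2
  have hKb : MemLp (fderiv ℝ G) 2 (volume : Measure (EuclideanSpace ℝ (Fin 3))) := by
    refine ⟨hDGc.aestronglyMeasurable, lintegral_enorm_sq_lt_top_iff_eLpNorm.1 (lt_of_le_of_lt (lintegral_mono fun x => ?_) hG1)⟩
    rw [← ofReal_norm, ← ofReal_norm, ← norm_iteratedFDeriv_fderiv, norm_iteratedFDeriv_zero]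
  have hA := tendsto_lintegral_backwardQuotient_sub_fderiv (F := fderiv ℝ Ψ) hDΨ1 hDa
  have hB := tendsto_lintegral_verticalAverage_sub (K := fderiv ℝ G) hDGc hKb
  -- squeeze
  have hlim : Tendsto (fun h : ℝ => (2 * ∫⁻ x, ‖h⁻¹ • (fderiv ℝ Ψ x - fderiv ℝ Ψ (x + (-h) • e₂)) - fderiv ℝ (fderiv ℝ Ψ) x e₂‖ₑ ^ 2) +
      2 * ∫⁻ x, ‖h⁻¹ • (∫ t in (-h)..0, fderiv ℝ G (x + t • e₂)) - fderiv ℝ G x‖ₑ ^ 2) (𝓝[>] 0) (𝓝 0) := by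
    have h := (ENNReal.Tendsto.const_mul (a := 2) hA (Or.inr ENNReal.ofNat_ne_top)).add
      (ENNReal.Tendsto.const_mul (a := 2) hB (Or.inr ENNReal.ofNat_ne_top))
    simpa using h
  refine tendsto_of_tendsto_of_tendsto_of_le_of_le' tendsto_const_nhds hlim (Eventually.of_forall fun _ => bot_le) ?_
  filter_upwards [eventually_mem_nhdsWithin] with h hh
  have hpos : 0 < h := hh
  -- pointwise identity and bound
  have hpt : ∀ x, ‖h⁻¹ • fderiv ℝ (fun x : EuclideanSpace ℝ (Fin 3) =>
        g (x 2) • V x - g ((x + (-h) • e₂) 2) • V (x + (-h) • e₂) -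
          (∫ t in (-h)..0, deriv g ((x + t • e₂) 2) * V (x + t • e₂) 2) • e₂) x -
        fderiv ℝ (fun y : EuclideanSpace ℝ (Fin 3) => g (y 2) • fderiv ℝ V y e₂ + deriv g (y 2) • (V y - (V y 2) • e₂)) x‖ₑ ^ 2 ≤
      2 * ‖h⁻¹ • (fderiv ℝ Ψ x - fderiv ℝ Ψ (x + (-h) • e₂)) - fderiv ℝ (fderiv ℝ Ψ) x e₂‖ₑ ^ 2 +
        2 * ‖h⁻¹ • (∫ t in (-h)..0, fderiv ℝ G (x + t • e₂)) - fderiv ℝ G x‖ₑ ^ 2 := by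
    intro x
    rw [fderiv_slideQuotient_eq hV hg h x, fderiv_slideGenerator_eq' hV hg x]
    have hid : h⁻¹ • (fderiv ℝ Ψ x - fderiv ℝ Ψ (x + (-h) • e₂) -
        (∫ t in (-h)..0, fderiv ℝ G (x + t • e₂)).smulRight e₂) -
        (fderiv ℝ (fderiv ℝ Ψ) x e₂ - (fderiv ℝ G x).smulRight e₂) =
        (h⁻¹ • (fderiv ℝ Ψ x - fderiv ℝ Ψ (x + (-h) • e₂)) - fderiv ℝ (fderiv ℝ Ψ) x e₂) -
          (h⁻¹ • (∫ t in (-h)..0, fderiv ℝ G (x + t • e₂)) - fderiv ℝ G x).smulRight e₂ := by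
      refine ContinuousLinearMap.ext fun w => ?_
      simp only [sub_apply, smul_apply, ContinuousLinearMap.smulRight_apply, sub_smul, smul_assoc]
      module
    rw [hid]
    -- `‖a − b‖ₑ² ≤ 2‖a‖ₑ² + 2‖b‖ₑ²` (cf. `Literature.Analysis.FluidPDE.enorm_sub_sq_le_two_mul`)
    have hsq : ∀ (a b : EuclideanSpace ℝ (Fin 3) →L[ℝ] EuclideanSpace ℝ (Fin 3)), ‖a - b‖ₑ ^ 2 ≤ 2 * ‖a‖ₑ ^ 2 + 2 * ‖b‖ₑ ^ 2 := by
      intro a b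
      have h : ‖a - b‖ ^ 2 ≤ 2 * ‖a‖ ^ 2 + 2 * ‖b‖ ^ 2 := by
        nlinarith [norm_sub_le a b, norm_nonneg (a - b), norm_nonneg a, norm_nonneg b, sq_nonneg (‖a‖ - ‖b‖)]
      have h2 : ENNReal.ofReal (2 * ‖a‖ ^ 2 + 2 * ‖b‖ ^ 2) = 2 * ‖a‖ₑ ^ 2 + 2 * ‖b‖ₑ ^ 2 := by
        rw [ENNReal.ofReal_add (by positivity) (by positivity), ENNReal.ofReal_mul (by norm_num),
          ENNReal.ofReal_mul (by norm_num), ENNReal.ofReal_pow (norm_nonneg _), ENNReal.ofReal_pow (norm_nonneg _),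
          ofReal_norm, ofReal_norm, show ENNReal.ofReal (2 : ℝ) = 2 from ENNReal.ofReal_ofNat 2]
      calc ‖a - b‖ₑ ^ 2 = ENNReal.ofReal (‖a - b‖ ^ 2) := by rw [← ofReal_norm, ENNReal.ofReal_pow (norm_nonneg _)]
        _ ≤ ENNReal.ofReal (2 * ‖a‖ ^ 2 + 2 * ‖b‖ ^ 2) := ENNReal.ofReal_le_ofReal h
        _ = _ := h2
    have hsr : ∀ b : EuclideanSpace ℝ (Fin 3) →L[ℝ] ℝ, ‖b.smulRight e₂‖ₑ = ‖b‖ₑ := fun b => by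
      rw [← ofReal_norm, ← ofReal_norm, ContinuousLinearMap.norm_smulRight_apply, he₂, PiLp.norm_single, norm_one, mul_one]
    calc ‖(h⁻¹ • (fderiv ℝ Ψ x - fderiv ℝ Ψ (x + (-h) • e₂)) - fderiv ℝ (fderiv ℝ Ψ) x e₂) -
          (h⁻¹ • (∫ t in (-h)..0, fderiv ℝ G (x + t • e₂)) - fderiv ℝ G x).smulRight e₂‖ₑ ^ 2
        ≤ 2 * ‖h⁻¹ • (fderiv ℝ Ψ x - fderiv ℝ Ψ (x + (-h) • e₂)) - fderiv ℝ (fderiv ℝ Ψ) x e₂‖ₑ ^ 2 +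
          2 * ‖(h⁻¹ • (∫ t in (-h)..0, fderiv ℝ G (x + t • e₂)) - fderiv ℝ G x).smulRight e₂‖ₑ ^ 2 := hsq _ _
      _ = _ := by rw [hsr]
  -- measurability of the first summand (continuous in `x`)
  have hc1 : Continuous fun x => h⁻¹ • (fderiv ℝ Ψ x - fderiv ℝ Ψ (x + (-h) • e₂)) - fderiv ℝ (fderiv ℝ Ψ) x e₂ := by
    have hcD : Continuous (fderiv ℝ Ψ) := hDΨs.continuous
    have hcD2 : Continuous (fderiv ℝ (fderiv ℝ Ψ)) := hDΨs.continuous_fderiv (by simp)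
    have hA1 : Continuous fun x => fderiv ℝ Ψ (x + (-h) • e₂) := hcD.comp (continuous_id.add continuous_const)
    have hA2 : Continuous fun x => fderiv ℝ (fderiv ℝ Ψ) x e₂ := hcD2.clm_apply continuous_const
    exact ((hcD.sub hA1).const_smul h⁻¹).sub hA2
  have hm1 : AEMeasurable (fun x => 2 * ‖h⁻¹ • (fderiv ℝ Ψ x - fderiv ℝ Ψ (x + (-h) • e₂)) - fderiv ℝ (fderiv ℝ Ψ) x e₂‖ₑ ^ 2)
      (volume : Measure (EuclideanSpace ℝ (Fin 3))) :=
    ((hc1.measurable.enorm.pow_const 2).const_mul 2).aemeasurable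
  calc ∫⁻ x, ‖h⁻¹ • fderiv ℝ (fun x : EuclideanSpace ℝ (Fin 3) =>
        g (x 2) • V x - g ((x + (-h) • e₂) 2) • V (x + (-h) • e₂) -
          (∫ t in (-h)..0, deriv g ((x + t • e₂) 2) * V (x + t • e₂) 2) • e₂) x -
        fderiv ℝ (fun y : EuclideanSpace ℝ (Fin 3) => g (y 2) • fderiv ℝ V y e₂ + deriv g (y 2) • (V y - (V y 2) • e₂)) x‖ₑ ^ 2
      ≤ ∫⁻ x, (2 * ‖h⁻¹ • (fderiv ℝ Ψ x - fderiv ℝ Ψ (x + (-h) • e₂)) - fderiv ℝ (fderiv ℝ Ψ) x e₂‖ₑ ^ 2 +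
          2 * ‖h⁻¹ • (∫ t in (-h)..0, fderiv ℝ G (x + t • e₂)) - fderiv ℝ G x‖ₑ ^ 2) := lintegral_mono hpt
    _ = (2 * ∫⁻ x, ‖h⁻¹ • (fderiv ℝ Ψ x - fderiv ℝ Ψ (x + (-h) • e₂)) - fderiv ℝ (fderiv ℝ Ψ) x e₂‖ₑ ^ 2) +
          2 * ∫⁻ x, ‖h⁻¹ • (∫ t in (-h)..0, fderiv ℝ G (x + t • e₂)) - fderiv ℝ G x‖ₑ ^ 2 := by
        rw [lintegral_add_left' hm1, lintegral_const_mul' _ _ ENNReal.ofNat_ne_top,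
          lintegral_const_mul' _ _ ENNReal.ofNat_ne_top]

end ExtremiserLiouville

end Summit.NavierStokesRegularity.NavierStokesRegularity.Theorems

end
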